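import Mathlib
import Literature.NumberTheory.Transcendental.ZagierDilogarithmConjecture
import Summits.KontsevichZagierPeriods.KontsevichZagierPeriods.Theorems.HyperbolicBlochZagierDilogarithmConjectureStubKummerDescent
import Summits.KontsevichZagierPeriods.KontsevichZagierPeriods.Theorems.HyperbolicBlochZagierDilogarithmConjectureGaloisRegulator
import HarnessLib

/-!
# Explained combinations stay explained under every Galois twist

Stub `stub_twist_mem_closure` of the line `kummer-clausen-linearisation` (reshape c2,
"Galois descent") for the crux `ZagierDilogarithmConjecture` (stmt-KontsevichZagierPeriods-10550,
route `HyperbolicBloch`): the EXACTNESS half of the reshape.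

Write `C := AddSubgroup.closure dilogRelators ⊆ ℤ[ℂ]` (`FreeAbelianGroup ℂ`) and
`ℚ̄ := algebraicClosure ℚ ℂ`. For a combination `β = Σ nᵢ[zᵢ]`, a `ℚ`-embedding `σ : ℚ̄ → ℂ` and
lifts `wᵢ, w'ᵢ ∈ ℚ̄` of `zᵢ, z̄ᵢ` put `σ_*ξ := Σ nᵢ([σwᵢ] − [σw'ᵢ])` (the Galois twist of the
conjugation-odd double `ξ = Σ nᵢ([zᵢ] − [z̄ᵢ])` of `β`).

**Exactness** (`stub_twist_mem_closure`): `β ∈ C ⇒ σ_*ξ ∈ C` for every `σ` and all lifts.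

Proof: the additive *twist map* `Φ_σ : ℤ[ℂ] →+ ℤ[ℂ]`, `[x] ↦ [σx] − [σx̄]` for algebraic `x` and
`[x] ↦ 0` otherwise (`exists_twistMap`, the `FreeAbelianGroup.lift` of this generator
assignment; no definition is introduced, the lemmas quantify over all such `Φ`) satisfies
`Φ_σ β = σ_*ξ` (`twistMap_sum_zsmul_of`) and maps `C` into `C` (`twistMap_mem_closure`):
* a five-term relator at algebraic `(x, y)` goes to the DIFFERENCE of the five-term relators at
  `(σx, σy)` and at `(σx̄, σȳ)` (`twistMap_fiveTerm_mem_closure`): `σ` and complex conjugation are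
  injective ring homomorphisms, so the five arguments `x, y, y/x, (1 − x⁻¹)/(1 − y⁻¹),
  (1 − x)/(1 − y)` are carried to the corresponding five arguments at `(σx, σy)`, resp.
  `(σx̄, σȳ)`, which are again algebraic, `∉ {0, 1}` and distinct;
* `[u] + [ū]` (`u` algebraic) goes to `([σu] − [σū]) + ([σū] − [σu]) = 0`;
* `[u]` (`u` real) goes to `0`: `ū = u` if `u` is algebraic, and `Φ_σ[u] = 0` by definition if not.

Sources: Neumann 1998 §2 (the relator group, eq. (2.3)); Zagier 2007 Ch. I §§3–4. The twist
computation is elementary [folklore]; it is the `ℤ[ℂ]`-valued shadow of the soundness of the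
Galois-twisted regulator (`galoisRegulator_eq_zero_of_mem_closure`, gen-2).
Not here: the converse direction (Galois descent, `stub_galoisDescent`, conditional on Dupont) and
the self-similarity stubs of the line.
-/

noncomputable section

open scoped BigOperators ComplexConjugate
open Literature.NumberTheory.Transcendental

namespace Summit.KontsevichZagierPeriods.HyperbolicBloch.ZagierDilogarithmGaloisDescent

open Summit.KontsevichZagierPeriods.HyperbolicBloch.ZagierDilogarithm
  (isAlgebraic_conj conj_mem_algebraicClosure)

/-! ## §1 The twist map `Φ_σ : [x] ↦ [σx] − [σx̄]` -/

variable (σ : ↥(algebraicClosure ℚ ℂ) →ₐ[ℚ] ℂ)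

/-- **Existence of the twist map** at a `ℚ`-algebra embedding `σ : ℚ̄ → ℂ`
(`ℚ̄ = algebraicClosure ℚ ℂ`): an additive map `Φ : ℤ[ℂ] →+ ℤ[ℂ]` with `Φ[z] = [σ w] − [σ w']`
for algebraic `z` and any lifts `w, w' ∈ ℚ̄` of `z, z̄`, and `Φ[z] = 0` for transcendental `z` —
the additive extension (`FreeAbelianGroup.lift`) of this generator assignment. [folklore] -/
theorem exists_twistMap :
    ∃ Φ : FreeAbelianGroup ℂ →+ FreeAbelianGroup ℂ,
      (∀ (z : ℂ) (w w' : ↥(algebraicClosure ℚ ℂ)), (w : ℂ) = z → (w' : ℂ) = conj z →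
          Φ (FreeAbelianGroup.of z) = FreeAbelianGroup.of (σ w) - FreeAbelianGroup.of (σ w')) ∧
        ∀ z : ℂ, ¬IsAlgebraic ℚ z → Φ (FreeAbelianGroup.of z) = 0 := by
  classical
  refine ⟨FreeAbelianGroup.lift fun z => if h : IsAlgebraic ℚ z then
      FreeAbelianGroup.of (σ ⟨z, mem_algebraicClosure_iff.2 h⟩) -
        FreeAbelianGroup.of (σ ⟨conj z, mem_algebraicClosure_iff.2 (isAlgebraic_conj h)⟩) else 0,
    ?_, fun z hz => by rw [FreeAbelianGroup.lift_apply_of, dif_neg hz]⟩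
  rintro _ w w' rfl hw'
  have hz : IsAlgebraic ℚ (w : ℂ) := mem_algebraicClosure_iff.1 w.2
  have e' : w' = ⟨conj (w : ℂ), conj_mem_algebraicClosure w.2⟩ := Subtype.ext hw'
  subst e'
  rw [FreeAbelianGroup.lift_apply_of, dif_pos hz]

variable {σ}

/-- The value of a twist map `Φ` at `σ` on `β = Σ nᵢ[zᵢ]` in terms of lifts `wᵢ, w'ᵢ ∈ ℚ̄` of
`zᵢ, z̄ᵢ`: `Φ β = σ_*ξ = Σ nᵢ([σ wᵢ] − [σ w'ᵢ])`. [folklore] -/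
theorem twistMap_sum_zsmul_of (Φ : FreeAbelianGroup ℂ →+ FreeAbelianGroup ℂ)
    (hΦ : ∀ (z : ℂ) (w w' : ↥(algebraicClosure ℚ ℂ)), (w : ℂ) = z → (w' : ℂ) = conj z →
      Φ (FreeAbelianGroup.of z) = FreeAbelianGroup.of (σ w) - FreeAbelianGroup.of (σ w'))
    {k : ℕ} (z : Fin k → ℂ) (n : Fin k → ℤ) (w w' : Fin k → ↥(algebraicClosure ℚ ℂ))
    (hw : ∀ i, (w i : ℂ) = z i) (hw' : ∀ i, (w' i : ℂ) = conj (z i)) :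
    Φ (∑ i, n i • FreeAbelianGroup.of (z i)) =
      ∑ i, n i • (FreeAbelianGroup.of (σ (w i)) - FreeAbelianGroup.of (σ (w' i))) := by
  simp only [map_sum, map_zsmul]
  exact Finset.sum_congr rfl fun i _ => by rw [hΦ (z i) (w i) (w' i) (hw i) (hw' i)]

/-! ## §2 The twist map preserves the relator group -/

/-- A twist map `Φ` at `σ` sends a five-term relator with algebraic entries `(x, y)` into the
relator group: its image is the difference of the five-term relators at `(σx, σy)` and at
`(σx̄, σȳ)` (`σ` and `conj` are injective ring homomorphisms, so the five arguments are carried to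
the five arguments, which stay algebraic, `∉ {0, 1}` and distinct).
[cite: Neumann1998, §2 eq. (2.3)] -/
theorem twistMap_fiveTerm_mem_closure (Φ : FreeAbelianGroup ℂ →+ FreeAbelianGroup ℂ)
    (hΦ : ∀ (z : ℂ) (w w' : ↥(algebraicClosure ℚ ℂ)), (w : ℂ) = z → (w' : ℂ) = conj z →
      Φ (FreeAbelianGroup.of z) = FreeAbelianGroup.of (σ w) - FreeAbelianGroup.of (σ w'))
    {x y : ℂ} (hx : IsAlgebraic ℚ x) (hy : IsAlgebraic ℚ y) (hx0 : x ≠ 0) (hx1 : x ≠ 1)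
    (hy0 : y ≠ 0) (hy1 : y ≠ 1) (hxy : x ≠ y) :
    Φ (FreeAbelianGroup.of x - FreeAbelianGroup.of y + FreeAbelianGroup.of (y / x) -
        FreeAbelianGroup.of ((1 - x⁻¹) / (1 - y⁻¹)) + FreeAbelianGroup.of ((1 - x) / (1 - y))) ∈
      AddSubgroup.closure dilogRelators := by
  -- the lifts of `x, y, x̄, ȳ` to `ℚ̄`
  set X : ↥(algebraicClosure ℚ ℂ) := ⟨x, mem_algebraicClosure_iff.2 hx⟩
  set Y : ↥(algebraicClosure ℚ ℂ) := ⟨y, mem_algebraicClosure_iff.2 hy⟩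
  set X' : ↥(algebraicClosure ℚ ℂ) := ⟨conj x, mem_algebraicClosure_iff.2 (isAlgebraic_conj hx)⟩
  set Y' : ↥(algebraicClosure ℚ ℂ) := ⟨conj y, mem_algebraicClosure_iff.2 (isAlgebraic_conj hy)⟩
  have hinj : Function.Injective σ := (σ : ↥(algebraicClosure ℚ ℂ) →+* ℂ).injective
  -- the images under `σ` are algebraic
  haveI : Algebra.IsAlgebraic ℚ ↥(algebraicClosure ℚ ℂ) := algebraicClosure.isAlgebraic ℚ ℂ
  have halg : ∀ W : ↥(algebraicClosure ℚ ℂ), IsAlgebraic ℚ (σ W) := fun W =>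
    (Algebra.IsAlgebraic.isAlgebraic W).algHom σ
  -- non-degeneracy of the two image configurations
  have hx0' : conj x ≠ 0 := by simpa using (map_ne_zero (starRingEnd ℂ)).2 hx0
  have hy0' : conj y ≠ 0 := by simpa using (map_ne_zero (starRingEnd ℂ)).2 hy0
  have hx1' : conj x ≠ 1 := fun h => hx1 (by simpa using congrArg conj h)
  have hy1' : conj y ≠ 1 := fun h => hy1 (by simpa using congrArg conj h)
  have hxy' : conj x ≠ conj y := fun h => hxy (by simpa using congrArg conj h)
  have ne0 : ∀ {W : ↥(algebraicClosure ℚ ℂ)}, (W : ℂ) ≠ 0 → σ W ≠ 0 := fun hW h =>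
    hW (by rw [hinj (h.trans (map_zero σ).symm)]; rfl)
  have ne1 : ∀ {W : ↥(algebraicClosure ℚ ℂ)}, (W : ℂ) ≠ 1 → σ W ≠ 1 := fun hW h =>
    hW (by rw [hinj (h.trans (map_one σ).symm)]; rfl)
  have ne2 : ∀ {W V : ↥(algebraicClosure ℚ ℂ)}, (W : ℂ) ≠ V → σ W ≠ σ V := fun hW h =>
    hW (by rw [hinj h])
  have h1 := fiveTerm_mem_dilogRelators (halg X) (halg Y) (ne0 hx0) (ne1 hx1) (ne0 hy0) (ne1 hy1)
    (ne2 (W := X) (V := Y) hxy)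
  have h2 := fiveTerm_mem_dilogRelators (halg X') (halg Y') (ne0 hx0') (ne1 hx1') (ne0 hy0')
    (ne1 hy1') (ne2 (W := X') (V := Y') hxy')
  -- the values of `Φ` on the five generators
  have e1 : Φ (FreeAbelianGroup.of x) = FreeAbelianGroup.of (σ X) - FreeAbelianGroup.of (σ X') :=
    hΦ x X X' rfl rfl
  have e2 : Φ (FreeAbelianGroup.of y) = FreeAbelianGroup.of (σ Y) - FreeAbelianGroup.of (σ Y') :=
    hΦ y Y Y' rfl rfl
  have e3 : Φ (FreeAbelianGroup.of (y / x)) =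
      FreeAbelianGroup.of (σ Y / σ X) - FreeAbelianGroup.of (σ Y' / σ X') := by
    rw [hΦ (y / x) (Y / X) (Y' / X') rfl (by rw [map_div₀]; rfl), map_div₀, map_div₀]
  have e4 : Φ (FreeAbelianGroup.of ((1 - x⁻¹) / (1 - y⁻¹))) =
      FreeAbelianGroup.of ((1 - (σ X)⁻¹) / (1 - (σ Y)⁻¹)) -
        FreeAbelianGroup.of ((1 - (σ X')⁻¹) / (1 - (σ Y')⁻¹)) := by
    rw [hΦ ((1 - x⁻¹) / (1 - y⁻¹)) ((1 - X⁻¹) / (1 - Y⁻¹)) ((1 - X'⁻¹) / (1 - Y'⁻¹))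
      (by push_cast; rfl)
      (by rw [map_div₀, map_sub, map_sub, map_one, map_inv₀, map_inv₀]; push_cast; rfl)]
    simp only [map_div₀, map_sub, map_one, map_inv₀]
  have e5 : Φ (FreeAbelianGroup.of ((1 - x) / (1 - y))) =
      FreeAbelianGroup.of ((1 - σ X) / (1 - σ Y)) -
        FreeAbelianGroup.of ((1 - σ X') / (1 - σ Y')) := by
    rw [hΦ ((1 - x) / (1 - y)) ((1 - X) / (1 - Y)) ((1 - X') / (1 - Y')) (by push_cast; rfl)
      (by rw [map_div₀, map_sub, map_sub, map_one]; push_cast; rfl)]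
    simp only [map_div₀, map_sub, map_one]
  rw [map_add, map_sub, map_add, map_sub, e1, e2, e3, e4, e5]
  convert (AddSubgroup.closure dilogRelators).sub_mem (AddSubgroup.subset_closure h1)
    (AddSubgroup.subset_closure h2) using 1
  abel

/-- **The twist map preserves the relator group.** A twist map `Φ` at `σ` (with `Φ[z] = 0` for
real transcendental `z`) maps `⟨dilogRelators⟩` into itself: five-term relators by
`twistMap_fiveTerm_mem_closure`, `[u] + [ū]` (`u` algebraic) to
`([σu] − [σū]) + ([σū] − [σu]) = 0`, real `[u]` to `0` (`ū = u` when `u` is algebraic).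
[folklore] -/
theorem twistMap_mem_closure (Φ : FreeAbelianGroup ℂ →+ FreeAbelianGroup ℂ)
    (hΦ : ∀ (z : ℂ) (w w' : ↥(algebraicClosure ℚ ℂ)), (w : ℂ) = z → (w' : ℂ) = conj z →
      Φ (FreeAbelianGroup.of z) = FreeAbelianGroup.of (σ w) - FreeAbelianGroup.of (σ w'))
    (hΦ' : ∀ z : ℂ, z.im = 0 → ¬IsAlgebraic ℚ z → Φ (FreeAbelianGroup.of z) = 0)
    {c : FreeAbelianGroup ℂ} (hc : c ∈ AddSubgroup.closure dilogRelators) :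
    Φ c ∈ AddSubgroup.closure dilogRelators := by
  refine (AddSubgroup.closure_le (K := (AddSubgroup.closure dilogRelators).comap Φ)).2 ?_ hc
  rintro r hr
  rw [SetLike.mem_coe, AddSubgroup.mem_comap]
  rcases hr with ((⟨x, y, hx, hy, hx0, hx1, hy0, hy1, hxy, rfl⟩ | ⟨u, hu, rfl⟩) | ⟨u, hu, rfl⟩)
  · exact twistMap_fiveTerm_mem_closure Φ hΦ hx hy hx0 hx1 hy0 hy1 hxy
  · set U : ↥(algebraicClosure ℚ ℂ) := ⟨u, mem_algebraicClosure_iff.2 hu⟩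
    set U' : ↥(algebraicClosure ℚ ℂ) := ⟨conj u, mem_algebraicClosure_iff.2 (isAlgebraic_conj hu)⟩
    rw [map_add, hΦ u U U' rfl rfl, hΦ (conj u) U' U rfl (by simp [U]), sub_add_sub_cancel,
      sub_self]
    exact zero_mem _
  · by_cases ha : IsAlgebraic ℚ u
    · set U : ↥(algebraicClosure ℚ ℂ) := ⟨u, mem_algebraicClosure_iff.2 ha⟩
      rw [hΦ u U U rfl (by simpa [U] using (Complex.conj_eq_iff_im.2 hu).symm), sub_self]
      exact zero_mem _
    · rw [hΦ' u hu ha]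
      exact zero_mem _

/-! ## §3 The stub -/

/-- **Explained combinations stay explained under every Galois twist (EXACTNESS of the reshape
"Galois descent").** If `β = Σ nᵢ[zᵢ] ∈ ⟨dilogRelators⟩` then
`σ_*ξ = Σ nᵢ([σwᵢ] − [σw'ᵢ]) ∈ ⟨dilogRelators⟩` for every `ℚ`-embedding `σ : ℚ̄ → ℂ`
(`ℚ̄ = algebraicClosure ℚ ℂ`) and all lifts `wᵢ, w'ᵢ ∈ ℚ̄` of `zᵢ, z̄ᵢ`: the twist map
`[x] ↦ [σx] − [σx̄]` (algebraic `x`; `0` otherwise) sends `β` to `σ_*ξ` and the relator group into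
itself. Hence self-similarity is necessary for being explained. [folklore] -/
theorem stub_twist_mem_closure :
    ∀ (k : ℕ) (z : Fin k → ℂ) (n : Fin k → ℤ),
      (∑ i, n i • FreeAbelianGroup.of (z i)) ∈ AddSubgroup.closure dilogRelators →
        ∀ (σ : ↥(algebraicClosure ℚ ℂ) →ₐ[ℚ] ℂ) (w w' : Fin k → ↥(algebraicClosure ℚ ℂ)),
          (∀ i, (w i : ℂ) = z i) → (∀ i, (w' i : ℂ) = conj (z i)) →
          (∑ i, n i • (FreeAbelianGroup.of (σ (w i)) - FreeAbelianGroup.of (σ (w' i)))) ∈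
            AddSubgroup.closure dilogRelators := by
  intro k z n hβ σ w w' hw hw'
  obtain ⟨Φ, hΦ, hΦ'⟩ := exists_twistMap σ
  rw [← twistMap_sum_zsmul_of Φ hΦ z n w w' hw hw']
  exact twistMap_mem_closure Φ hΦ (fun x _ hx => hΦ' x hx) hβ

end Summit.KontsevichZagierPeriods.HyperbolicBloch.ZagierDilogarithmGaloisDescent

end
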